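import Summits.QuantumFields.BalabanUV.Beta.FP.NestedDeadRowsOrderTwoTowerClosedG
import Summits.QuantumFields.BalabanUV.Beta.FP.TorusCompositeObjectsG
import Summits.QuantumFields.BalabanUV.Beta.FP.TorusCompositeSlice
import Summits.QuantumFields.BalabanUV.Beta.FP.TorusCompositeCovariance
import Summits.QuantumFields.BalabanUV.Beta.FP.TorusEffFormCompositeGB
import Summits.QuantumFields.BalabanUV.Beta.FP.NestedStepLawTorusComposite
import Summits.QuantumFields.BalabanUV.Beta.FP.NestedStepLawTorusCompositeOneShot
import Summits.QuantumFields.BalabanUV.Beta.FP.NestedStepLawTorusCompositeOneShotTopSym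
import Summits.QuantumFields.BalabanUV.Beta.FP.RelInvPeriodisedCombRows
import Summits.QuantumFields.BalabanUV.Beta.FP.RelInvPeriodisedEffFormCoarse

/-!
# `BalabanUV.Beta.FP.TowerUTopClosedRooted` — road «FP» for binder row D1, ROUTE T, v11-R (W-8 R-1 ∕ (R-root)): **#21's `uTop` SLOT CLOSED AT THE ROOTED ROWS FOR
# EVERY TOP SOURCE, NOTHING DISPLAYED BUT THE PINS** — the rooted twin of `TowerUTopClosedSymB.torus_uTop_towerSym_closed` (the first letter the rooted
# named tower law `TowerKernelLawNamedRooted` discharges)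

WHY.  Under the row's (R-root) ruling (an2 W-8 R-1, journal l.69055; `A2-ROW-v11.md` §2) the END's constraint rows go ROOTED — single comb order at the centred
root `ctrOff (d+1) Lc` at every storey: `Q₁₀ = compRows Lc M′ lev (fun _ => ctrOff (d+1) Lc) (n+1)` (leaf-06 `TorusCompositeObjects.compRows`, the nested product of
rooted one-step rows `Qstep`) and the top step's slot rows `Q₂₀ = (perF M′ (bhKStepAt d (toSite (ctrOff (d+1) Lc)) Lc (lev 0))).submatrix (slots) (fields)` — while
v10's per-storey tower law `TowerKernelLawNamedC` and its first naming letter `TowerUTopClosedSymB` display the (0.4)-SYMMETRISED texts (`compRowsSym`, `bhKStepSh·Dsh`).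
THIS FILE is `TowerUTopClosedSymB` VERBATIM with the two row tokens moved (`compRowsSym ↦ compRows` ×3, `bhKStepSh d Lc (Dsh Lc) (lev 0) ↦ bhKStepAt d (toSite (ctrOff
(d+1) Lc)) Lc (lev 0)` in `hQ₂₀`; the finest form's `hH₀` keeps its sym `ff` text — root-free by `bhKStepSh_Dsh_inl_inl_eq_bhKStepAt`), proved by the SAME generic letter
leaf-06 G-5 §2 `NestedDeadRowsOrderTwoTowerClosedG.torus_uTop_tower_closedG` at the rooted step-row family `fun M _ ℓ r => Qstep Lc M ℓ r` (`compRows_eq_compRowsG ∕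
nestedSlice_eq_nestedSliceG`, `rfl`-inductions), its letters inhabited by the ROOTED record BY NAME: `c0 :=` leaf-02 `compRows_mul_towerGen_succ`, `hSL :=` leaf-06
`det_nestedSlice_mul_towerGen_ne_zero`, `a0 :=` `torus_a0_tower`, `hH₀t :=` `H₀_transpose_of_dvd`, `hInv ∕ hEff :=` leaf-05 L5G §2 `torus_composite_inv_and_eff_G` fed
leaf-05's one-step letters `torus_h1 ∕ hId_order_zero_record` (`c := ∏_{i<n+1} (wVH d Lc (lev i))⁻¹ ≠ 0` by `wVH_pos`), `h2F :=` `torus_isUnit_det_kkt_combRows`,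
`σ′ := σ_{n+1} ≠ 0` by `prod_stepScale_mul_card_ne_zero` — exactly the feed of road `TorusWJunctionOfNLegRooted` (p748998) ∕ an2 PART 88.

WHAT.  §1 **`torus_uTop_towerRooted_closed`** — binders = `torus_uTop_towerSym_closed`'s, token for token but for `hQ₁₀ hQ₂₀ hDb₁ hDb₂`'s row tokens ⊢
`secondVar (τ₂ * Dbar) (τ₂ * Db₁) (τ₂ * Db₂) = 0`.  [folklore] composition BY NAME; no `def`, no `def … : Prop`, nothing cited, 0 sorry, default heartbeats.
Nothing of the dictionary ∕ Bałaban's asserted; 0 estimates; the rows are the row's (R-root) texts, quoted.  NOT the tower law (next file), NOT the END.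

HONEST DEPENDENCY (page 1, mandatory): continuum YM on T⁴ ⇐ BetaPertH ∧ nine spine estimates (0/9 proved); BetaPertH ⇐ (D1) ∧ (D4) ∧ CAP+tail;
G-an2-4 gates asym, D1 and NE2/3/4.  HONEST FRAMING (cell contract, verbatim): «discharging `BetaPertH` makes Bałaban's UV stability UNCONDITIONAL —
a real constructive-QFT result; it is NOT the continuum limit and NOT the Clay problem.»  ABSOLUTE RULE (cell charter, verbatim): «No internally-minted
statement may enter as a cited fact. Every hypothesis is either kernel-proved in this package or a verbatim quotation of a PUBLISHED theorem with page
reference. The manuscript(s) under audit are NOT citable for their own disputed steps — they are the thing under adjudication; programme-internal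
(2001/route/tribunal) claims are never citable.»  0 estimates; 0∕4 row-D1 binders (hW, hR, D1Tel, D1Rep); NOT (C1), NOT (L2′), NOT (T-ID) complete, NOT SDF,
NOT D1, NOT BetaPertH, NOT continuum, NOT Clay.  Road «FP» OWNER, b2b-balaban-beta-d1-p3 gen 61 (v1), 2026-08-29.  No existing file touched.
-/

noncomputable section

open scoped BigOperators Matrix

namespace Summit.QuantumFields.BalabanUV.Beta.FP.TowerUTopClosedRooted

open Matrix Finset
open Literature.Probability.LatticeModels (Torus.proj)
open Literature.MathematicalPhysics.QuantumFieldTheory.Balaban1983to89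
open Literature.MathematicalPhysics.QuantumFieldTheory.Balaban1983to89.Beta
open Literature.MathematicalPhysics.QuantumFieldTheory.Balaban1983to89.Beta.Composition (kkt)
open Literature.MathematicalPhysics.QuantumFieldTheory.Balaban1983to89.Beta.CompositionSingular (effForm minOp)
open B5Prop11Plancherel (fine)
open B6Lemma24Torus (pbox)
open AffineAveraging (Site box toSite unitVec)
open AveragingContoursRooted (ctrOff ctrOff_mem_box)
open OneStepResolventKernel (Fib)
open BalabanStepJetsSucc (wVH)
open Summit.QuantumFields.BalabanUV.Beta.BorderedHessian (bhKStepAt stepScale)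
open Summit.QuantumFields.BalabanUV.Beta.SymShiftedSpread (bhKStepSh)
open Summit.QuantumFields.BalabanUV.Beta.DshAn1 (Dsh)
open Summit.QuantumFields.BalabanUV.Beta.D1BFx.LogDetSecondVariation (secondVar)
open Summit.QuantumFields.BalabanUV.Beta.FP.KernelPeriodisationFib (Idx perF perF_apply perZ_apply)
open Summit.QuantumFields.BalabanUV.Beta.FP.TorusCombRows (Res)
open Summit.QuantumFields.BalabanUV.Beta.FP.TorusGaugeCovariance (tgrad tdelta)
open Summit.QuantumFields.BalabanUV.Beta.FP.TorusGaugeCovarianceCoarse (coarsePt coarsePt_coe)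
open Summit.QuantumFields.BalabanUV.Beta.FP.TorusCompositeObjects (towerTorus NParam combF bigP towerGen compRows nestedSlice Qstep)
open Summit.QuantumFields.BalabanUV.Beta.FP.TorusCompositeObjectsG (compRows_eq_compRowsG nestedSlice_eq_nestedSliceG)
open Summit.QuantumFields.BalabanUV.Beta.GAN24.FineReadoutCauchyFrame (toSite_mem_range)
open Summit.QuantumFields.BalabanUV.Beta.FP.RelInvPeriodisedEffFormCoarse (wVH_pos hId_order_zero_record)
open Summit.QuantumFields.BalabanUV.Beta.FP.RelInvPeriodisedCombRows (torus_isUnit_det_kkt_combRows)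
open Summit.QuantumFields.BalabanUV.Beta.FP.TorusCompositeSlice (prod_stepScale_mul_card_ne_zero det_nestedSlice_mul_towerGen_ne_zero)
open Summit.QuantumFields.BalabanUV.Beta.FP.TorusCompositeCovariance (compRows_mul_towerGen_succ)
open Summit.QuantumFields.BalabanUV.Beta.FP.TorusEffFormCompositeGB (torus_composite_inv_and_eff_G)
open Summit.QuantumFields.BalabanUV.Beta.FP.NestedStepLawTorusInstance (dvd_fine coarseSlot_injective coarseSlot_range torus_h1)
open Summit.QuantumFields.BalabanUV.Beta.FP.NestedStepLawTorusComposite (H₀_transpose_of_dvd dvd_towerTorus_succ)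
open Summit.QuantumFields.BalabanUV.Beta.FP.NestedStepLawTorusCompositeOneShot (torus_a0_tower)
open Summit.QuantumFields.BalabanUV.Beta.FP.NestedStepLawTorusCompositeOneShotTopSym (bhKStepSh_Dsh_inl_inl_eq_bhKStepAt)
open Summit.QuantumFields.BalabanUV.Beta.FP.NestedDeadRowsOrderTwoTowerClosedG (torus_uTop_tower_closedG)

variable {d : ℕ}

/-! ## §1 #21's `uTop` CLOSED at the ROOTED rows for every top source: G-5 §2 with `c0 hSL a0 hH₀t hInv hEff h2F` discharged by name -/

section UTop

variable (M' : Fin (d + 1) → ℕ) [∀ μ, NeZero (M' μ)] (Lc : ℕ) [NeZero Lc] (lev : ℕ → ℕ) (n : ℕ)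

set_option synthInstance.maxSize 1024 in
/-- [folklore] **`uTop` OF #21 AT THE ROOTED ROWS FOR THE NESTED COMPOSITE COLUMN OF ANY TOP SOURCE `v`, NOTHING DISPLAYED BUT THE PINS** (the rooted twin of
`TowerUTopClosedSymB.torus_uTop_towerSym_closed`: `hQ₁₀ hQ₂₀ hDb₁ hDb₂` carry W-8 R-1's rooted tokens `compRows ∕ bhKStepAt d (toSite (ctrOff (d+1) Lc)) Lc`,
every other binder and the conclusion CHARACTER FOR CHARACTER): G-5 §2 `torus_uTop_tower_closedG` at `Q := fun M _ ℓ r => Qstep Lc M ℓ r` with `c0 :=` leaf-02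
`compRows_mul_towerGen_succ`, `hSL :=` `det_nestedSlice_mul_towerGen_ne_zero`, `a0 :=` `torus_a0_tower`, `hH₀t :=` `H₀_transpose_of_dvd`, `hInv ∕ hEff :=`
`torus_composite_inv_and_eff_G` (fed `torus_h1 ∕ hId_order_zero_record`; `c := ∏ (wVH)⁻¹ ≠ 0` by `wVH_pos`), `h2F :=` `torus_isUnit_det_kkt_combRows`, `σ′ ≠ 0` by
`prod_stepScale_mul_card_ne_zero`. -/
theorem torus_uTop_towerRooted_closed (hlev : ∀ i, i ≤ n → lev i = lev (i + 1) + 1) (hM' : ∀ i, Lc ∣ M' i)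
    {κ : Type*} [Fintype κ] [DecidableEq κ] (pμ' : κ → ↥(pbox M')) (mμ' : κ → Fin (d + 1))
    (hfμ' : Function.Injective (fun a : κ => ((pμ' a, Sum.inr (mμ' a)) : Idx M' (Fib d))))
    (hcoarse' : ∀ (s : ↥(pbox M')) (m : Fin (d + 1)),
      ((s, Sum.inr m) : Idx M' (Fib d)) ∈ Set.range (fun a : κ => ((pμ' a, Sum.inr (mμ' a)) : Idx M' (Fib d))) ↔ Torus.proj Lc (s : Site (d + 1)) = 0)
    {H₀ : Matrix (↥(pbox (towerTorus Lc M' (n + 1))) × Fin (d + 1)) (↥(pbox (towerTorus Lc M' (n + 1))) × Fin (d + 1)) ℝ}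
    (hH₀ : H₀ = (perF (towerTorus Lc M' (n + 1)) (bhKStepSh d Lc (Dsh Lc) (lev (n + 1)))).submatrix
        (fun b : ↥(pbox (towerTorus Lc M' (n + 1))) × Fin (d + 1) => ((b.1, Sum.inl b.2) : Idx (towerTorus Lc M' (n + 1)) (Fib d)))
        (fun b : ↥(pbox (towerTorus Lc M' (n + 1))) × Fin (d + 1) => ((b.1, Sum.inl b.2) : Idx (towerTorus Lc M' (n + 1)) (Fib d))))
    {Q₁₀ : Matrix (↥(pbox M') × Fin (d + 1)) (↥(pbox (towerTorus Lc M' (n + 1))) × Fin (d + 1)) ℝ}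
    (hQ₁₀ : Q₁₀ = compRows Lc M' lev (fun _ : ℕ => ctrOff (d + 1) Lc) (n + 1))
    {τ₁ : Matrix (NParam Lc (fine Lc M') (fun _ : ℕ => ctrOff (d + 1) Lc) n) (↥(pbox (towerTorus Lc M' (n + 1))) × Fin (d + 1)) ℝ}
    (hτ₁ : τ₁ = bigP Lc (fine Lc M') (fun _ : ℕ => ctrOff (d + 1) Lc)
      (fun _ => toSite_mem_range (ctrOff_mem_box (d := d + 1) (Nat.one_le_iff_ne_zero.mpr (NeZero.ne Lc)))) n)
    {τ₂ : Matrix (Res (toSite (ctrOff (d + 1) Lc)) Lc M') (↥(pbox M') × Fin (d + 1)) ℝ} (hτ₂ : τ₂ = combF Lc M' (ctrOff (d + 1) Lc))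
    {Q₂₀ : Matrix κ (↥(pbox M') × Fin (d + 1)) ℝ}
    (hQ₂₀ : Q₂₀ = (perF M' (bhKStepAt d (toSite (ctrOff (d + 1) Lc)) Lc (lev 0))).submatrix (fun a : κ => ((pμ' a, Sum.inr (mμ' a)) : Idx M' (Fib d)))
        (fun b : ↥(pbox M') × Fin (d + 1) => ((b.1, Sum.inl b.2) : Idx M' (Fib d))))
    {Dbar : Matrix (↥(pbox M') × Fin (d + 1)) (Res (toSite (ctrOff (d + 1) Lc)) Lc M') ℝ}
    (hDbar : Dbar = (∏ i ∈ range (n + 1), (stepScale d Lc (lev (i + 1)) * ((box (d + 1) Lc).card : ℝ))) •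
        (tgrad M').submatrix (fun a : ↥(pbox M') × Fin (d + 1) => ((a.1, Sum.inl a.2) : Idx M' (Fib d))) (fun t : Res (toSite (ctrOff (d + 1) Lc)) Lc M' => (t.1 : ↥(pbox M'))))
    {I : Matrix (↥(pbox (towerTorus Lc M' (n + 1))) × Fin (d + 1)) ((↥(pbox M') × Fin (d + 1)) ⊕ (NParam Lc (fine Lc M') (fun _ : ℕ => ctrOff (d + 1) Lc) n)) ℝ}
    (hI : minOp H₀ (fromRows Q₁₀ τ₁) = I)
    {S : Matrix ((↥(pbox M') × Fin (d + 1)) ⊕ (NParam Lc (fine Lc M') (fun _ : ℕ => ctrOff (d + 1) Lc) n)) ((↥(pbox M') × Fin (d + 1)) ⊕ (NParam Lc (fine Lc M') (fun _ : ℕ => ctrOff (d + 1) Lc) n)) ℝ}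
    (hS : effForm H₀ (fromRows Q₁₀ τ₁) = S)
    (c : ℝ) (v : κ → ℝ)
    {h : ↥(pbox (towerTorus Lc M' (n + 1))) × Fin (d + 1) → ℝ} (hh : h = I *ᵥ Sum.elim (minOp S.toBlocks₁₁ (fromRows Q₂₀ τ₂) *ᵥ Sum.elim v 0) 0)
    {Db₁ : Matrix (↥(pbox M') × Fin (d + 1)) (Res (toSite (ctrOff (d + 1) Lc)) Lc M') ℝ}
    (hDb₁ : Db₁ = Matrix.of fun (a : ↥(pbox M') × Fin (d + 1)) (t : Res (toSite (ctrOff (d + 1) Lc)) Lc M') =>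
        -(c * (compRows Lc M' lev (fun _ : ℕ => ctrOff (d + 1) Lc) (n + 1) *ᵥ h) a * tdelta M' ((a.1 : Site (d + 1)) + unitVec a.2) t.1))
    {Db₂ : Matrix (↥(pbox M') × Fin (d + 1)) (Res (toSite (ctrOff (d + 1) Lc)) Lc M') ℝ}
    (hDb₂ : Db₂ = Matrix.of fun (a : ↥(pbox M') × Fin (d + 1)) (t : Res (toSite (ctrOff (d + 1) Lc)) Lc M') =>
        (c ^ 2 * (∏ i ∈ range (n + 1), (stepScale d Lc (lev (i + 1)) * ((box (d + 1) Lc).card : ℝ)))⁻¹)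
          * ((compRows Lc M' lev (fun _ : ℕ => ctrOff (d + 1) Lc) (n + 1) *ᵥ h) a) ^ 2 * tdelta M' ((a.1 : Site (d + 1)) + unitVec a.2) t.1) :
    secondVar (τ₂ * Dbar) (τ₂ * Db₁) (τ₂ * Db₂) = 0 := by
  have hL0 : 0 < Lc := Nat.pos_of_ne_zero (NeZero.ne Lc)
  have hc : ctrOff (d + 1) Lc ∈ box (d + 1) Lc := ctrOff_mem_box (d := d + 1) (Nat.one_le_iff_ne_zero.mpr (NeZero.ne Lc))
  -- the finest form's display, rooted spelling (the ff block sees neither the root nor `Dsh`)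
  have hH₀' : H₀ = (perF (towerTorus Lc M' (n + 1)) (bhKStepAt d (toSite (ctrOff (d + 1) Lc)) Lc (lev (n + 1)))).submatrix
      (fun b : ↥(pbox (towerTorus Lc M' (n + 1))) × Fin (d + 1) => ((b.1, Sum.inl b.2) : Idx (towerTorus Lc M' (n + 1)) (Fib d)))
      (fun b : ↥(pbox (towerTorus Lc M' (n + 1))) × Fin (d + 1) => ((b.1, Sum.inl b.2) : Idx (towerTorus Lc M' (n + 1)) (Fib d))) := by
    rw [hH₀]; ext p q
    simp only [Matrix.submatrix_apply, perF_apply, perZ_apply]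
    exact tsum_congr fun m => bhKStepSh_Dsh_inl_inl_eq_bhKStepAt Lc (toSite (ctrOff (d + 1) Lc)) (lev (n + 1)) _ _ _ _
  -- leaf-05 L5G §2 at the rooted one-step letters (PART 88's ∕ p748998's feed)
  have hIE := torus_composite_inv_and_eff_G Lc (fun (M : Fin (d + 1) → ℕ) (_ : ∀ μ, NeZero (M μ)) (ℓ : ℕ) (r : Fin (d + 1) → ℕ) => Qstep Lc M ℓ r)
    (fun ℓ r => bhKStepAt d (toSite r) Lc ℓ) n M' lev (fun _ : ℕ => ctrOff (d + 1) Lc) hlev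
    (fun k T _ => torus_h1 T hc (lev k))
    (fun k T _ r' => hId_order_zero_record T hc (lev k) r' (coarsePt T Lc) (coarsePt_coe T Lc) (coarseSlot_injective T) (coarseSlot_range T))
  -- the composite covariance row `c0` and the slice transversality at the rooted rows, BEFORE the generic re-spelling of `hQ₁₀`
  have c0 : Q₁₀ * towerGen Lc M' (fun _ : ℕ => ctrOff (d + 1) Lc) (n + 1) = Matrix.fromCols
      ((∏ i ∈ range (n + 1), (stepScale d Lc (lev (i + 1)) * ((box (d + 1) Lc).card : ℝ))) •
        (tgrad M').submatrix (fun a : ↥(pbox M') × Fin (d + 1) => ((a.1, Sum.inl a.2) : Idx M' (Fib d)))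
          (fun t : Res (toSite (ctrOff (d + 1) Lc)) Lc M' => (t.1 : ↥(pbox M'))))
      (0 : Matrix (↥(pbox M') × Fin (d + 1)) (NParam Lc (fine Lc M') (fun k => (fun _ : ℕ => ctrOff (d + 1) Lc) (k + 1)) n) ℝ) := by
    rw [hQ₁₀]
    exact compRows_mul_towerGen_succ Lc n M' lev (fun _ : ℕ => ctrOff (d + 1) Lc) (fun _ => hc)
  have hSL : (nestedSlice Lc (fine Lc M') (fun k => lev (k + 1)) (fun k => (fun _ : ℕ => ctrOff (d + 1) Lc) (k + 1)) n
      * towerGen Lc (fine Lc M') (fun k => (fun _ : ℕ => ctrOff (d + 1) Lc) (k + 1)) n).det ≠ 0 :=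
    det_nestedSlice_mul_towerGen_ne_zero Lc n (fine Lc M') (fun k => lev (k + 1)) (fun _ : ℕ => ctrOff (d + 1) Lc) (fun _ => hc) (dvd_fine M')
  rw [nestedSlice_eq_nestedSliceG] at hSL
  rw [compRows_eq_compRowsG] at hQ₁₀ hDb₁ hDb₂
  subst hI hS
  exact torus_uTop_tower_closedG M' Lc lev (fun _ : ℕ => ctrOff (d + 1) Lc) n
    (fun (M : Fin (d + 1) → ℕ) (_ : ∀ μ, NeZero (M μ)) (ℓ : ℕ) (r : Fin (d + 1) → ℕ) => Qstep Lc M ℓ r) (fun _ => hc) hM' H₀ hQ₁₀ hτ₁ hτ₂ Q₂₀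
    ((∏ i ∈ range (n + 1), (stepScale d Lc (lev (i + 1)) * ((box (d + 1) Lc).card : ℝ))) •
      (tgrad M').submatrix (fun a : ↥(pbox M') × Fin (d + 1) => ((a.1, Sum.inl a.2) : Idx M' (Fib d))) (fun t : Res (toSite (ctrOff (d + 1) Lc)) Lc M' => (t.1 : ↥(pbox M'))))
    c0 hSL
    (torus_a0_tower Lc M' lev (fun _ : ℕ => ctrOff (d + 1) Lc) n (fun _ => hc) hH₀' rfl)
    (H₀_transpose_of_dvd (dvd_towerTorus_succ (Lc := Lc) M' n) (lev (n + 1)) hH₀')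
    (by rw [hH₀', hQ₁₀]; exact hIE.1)
    (c := ∏ i ∈ range (n + 1), (wVH d Lc (lev i))⁻¹) (Finset.prod_ne_zero_iff.mpr fun i _ => inv_ne_zero (wVH_pos hL0 (lev i)).ne')
    (by rw [hH₀', hQ₁₀]; exact hIE.2 (ctrOff (d + 1) Lc))
    (by rw [hQ₂₀, hτ₂]; exact torus_isUnit_det_kkt_combRows M' hc hM' (lev 0) _ hfμ' (fun a => ⟨mμ' a, rfl⟩) hcoarse')
    (prod_stepScale_mul_card_ne_zero (d := d) Lc lev (n + 1)) hDbar v rfl hh c hDb₁ hDb₂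

end UTop

end Summit.QuantumFields.BalabanUV.Beta.FP.TowerUTopClosedRooted

end
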